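import Summits.BirchSwinnertonDyer.BirchSwinnertonDyer.Theorems.SylvesterTwoHeegnerIndexUpperPairForm
import Summits.BirchSwinnertonDyer.BirchSwinnertonDyer.Theorems.SylvesterTwoHeegnerIndexUpperInstances
import Literature.NumberTheory.EllipticCurves.BSDShaProofs
import HarnessLib

/-!
# Crux `TwoAdicPairHSY` (item 19580, child r201 of the Upper twin 19476): FIRST RUNG — the members of
# conductor `< 5000` (`p = 7`, `p = 13`) from PRINT, and the honesty clause «rung leaf + Cassels–Tate ⇒
# the crux»

HONEST FRAMING (cell «bsd-cm», D-0074 seat `bsd-cm-k7t-c2` gen 2; route `SylvesterTwoHeegnerIndex`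
rev 8, D98 split of 19476 into 19580 `TwoAdicPairHSY` / 19581 `UpperOffV0HSY` / 19582 glue). The crux
`TwoAdicPairHSY` — for every member `B ≅ E_p` of 𝒞_HSY and minimal partner `A ≅ E_{3p²}`:
`#Ш_an(B)·#Ш_an(A) ≠ 0` rational with `ord₂ (#Ш_an(B)·#Ш_an(A)) = 2n` — is the cell's refereed paper
theorem (memo two Thm B′/B″ + C) and is NOT proved here at class level. This file proves, sorry-free:

* `exists_two_mul_eq_padicValNat_of_isSquare` — `ord₂` of a nonzero square is even (bookkeeping);
* `twoAdicPair_of_bsdp_two` — per member: `BSD(B, 2)` + FULL BSD for the CM partner `A`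
  (Burungale–Flach) + the Cassels–Tate squareness of `#Ш` (named fact `exists_casselsTate_pairing`,
  Cassels 1962 / Silverman X.4.14) ⇒ the crux's clause at `(A, B)`: `ord₂ (qB·qA) = ord₂ #Ш(B) +
  ord₂ #Ш(A)`, both even;
* **`twoAdicPair_of_cmAtTwo`** — HONESTY CLAUSE: granted `PublishedFactsTwo` and Cassels–Tate, the rung
  leaf `X12.CMAtTwo` implies `TwoAdicPairHSY` verbatim — the new crux is NOT stronger than `BSD₂` on
  the class (plus a printed theorem), so the D98 split loses nothing;
* **`twoAdicPair_of_conductor_lt`** — FIRST RUNG: at a member of conductor `< 5000` the clause HOLDS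
  from print alone: Hu–Shu–Yin (rank `1`), Creutz–Miller 2012 (`bsdTriple_of_rank_le_one_of_conductor_lt`,
  full BSD for rank `≤ 1` and `N < 5000`), Burungale–Flach, Cassels–Tate; the conductor bound is a
  displayed Cremona datum;
* `twoAdicPairHSY_at_seven`, `twoAdicPairHSY_at_thirteen` — the crux's body VERBATIM at `p := 7`
  (`N = 441`) and `p := 13` (`N = 4563`), for ALL minimal models (conductor is model-independent,
  `conductorNorm_smul_rat`), modulo the one displayed datum `N(sylvesterCurve p) = 441 | 4563`.

WHAT THIS IS NOT: not the class statement (for `N ≥ 5000`, i.e. every `p ≥ 19`, nothing here applies);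
no Heegner point is computed; the values `n(7) = 0`, `n(13) = 1` of the memo are NOT asserted (only
evenness and existence of `n`). References: [CreutzMiller2012] Thm 1.1; [HuShuYin2019] Thm 1.3/1.4,
(bsd) p. 12; [BurungaleFlach2024] Thm 1.1, Cor. 2; [SilvermanAEC2009] Thm X.4.14; [Cassels1962ArithmeticIV];
[Miller2011LMS] Def. 1.1; parents p431591 (`…UpperPairForm`), p420359 (`…UpperInstances`).
-/

set_option autoImplicit false
set_option linter.dupNamespace false

noncomputable section

open scoped Classical

open WeierstrassCurve NumberField Literature.NumberTheory.EllipticCurves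
  Literature.NumberTheory.EllipticCurves.Rank1Residual
  Literature.NumberTheory.EllipticCurves.Rank1Residual.Typed
  Literature.NumberTheory.EllipticCurves.HuShuYin2019
  Summit.BirchSwinnertonDyer.Rank1Residual
  Summit.BirchSwinnertonDyer.BirchSwinnertonDyer.Theses.SylvesterTwoHeegnerIndex

namespace Summit.BirchSwinnertonDyer.BirchSwinnertonDyer.Theorems.SylvesterTwoUpper

/-! ## §0 Bookkeeping: `ord₂` of a nonzero square is even -/

/-- `ord₂ m` is even for a nonzero perfect square `m`. [folklore] -/
theorem exists_two_mul_eq_padicValNat_of_isSquare {m : ℕ} (hm : IsSquare m) (h0 : m ≠ 0) :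
    ∃ k : ℕ, padicValNat 2 m = 2 * k := by
  haveI : Fact (2 : ℕ).Prime := ⟨Nat.prime_two⟩
  obtain ⟨s, rfl⟩ := hm
  have hs : s ≠ 0 := fun h => h0 (by rw [h])
  exact ⟨padicValNat 2 s, by rw [padicValNat.mul hs hs]; ring⟩

/-! ## §1 Per member: `BSD(B, 2)` + Burungale–Flach + Cassels–Tate ⇒ the crux's clause -/

section Member

variable {p : ℕ}

/-- **Per member: `BSD(B, 2)` ⇒ the clause of `TwoAdicPairHSY` at `(A, B)`**, granted Hu–Shu–Yin
(`Ш(B)` finite, `#Ш_an(B)·#Ш_an(A) ≠ 0`), Burungale–Flach (full BSD for the CM rank-zero partner: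
`ord₂ #Ш_an(A) = ord₂ #Ш(A)`, `Ш(A)` finite), modularity, and the Cassels–Tate squareness of the order
of a finite `Ш` (named fact `exists_casselsTate_pairing`, hypothesis `hCT`):
`ord₂ (qB·qA) = ord₂ #Ш(B) + ord₂ #Ш(A) = 2(k_B + k_A)`. [cite: SilvermanAEC2009, Thm. X.4.14]
[cite: Cassels1962ArithmeticIV] [cite: BurungaleFlach2024, Thm. 1.1 and Cor. 2] [cite: Miller2011LMS, Def. 1.1] -/
theorem twoAdicPair_of_bsdp_two (hHSY : thm14_threePart_product)
    (hCM0 : bsdTriple_of_hasCM_of_L_one_ne_zero) (hmod : hasEntireLFunction_rat)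
    (hCT : WeierstrassCurve.exists_casselsTate_pairing (K := ℚ))
    (hp : p.Prime) (h9 : p % 9 = 4 ∨ p % 9 = 7) (h3 : ¬ ∃ x : ZMod p, x ^ 3 = 3)
    (A B : WeierstrassCurve ℚ) [A.IsElliptic] [A.IsGloballyMinimal] [B.IsElliptic]
    [B.IsGloballyMinimal] (hB : ∃ C : VariableChange ℚ, C • B = cubeSumCurve (p : ℚ))
    (hA : ∃ C : VariableChange ℚ, C • A = cubeSumCurve (3 * (p : ℚ) ^ 2)) (hb : BSDp B 2) :
    ∃ qB qA : ℚ, shaAn B = (qB : ℂ) ∧ shaAn A = (qA : ℂ) ∧ qB * qA ≠ 0 ∧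
      ∃ n : ℕ, padicValRat 2 (qB * qA) = 2 * n := by
  haveI : Fact (2 : ℕ).Prime := ⟨Nat.prime_two⟩
  obtain ⟨-, -, hfinB, -, hA0, -, -, -, qB, qA, hqB, hqA, hne, -⟩ := hHSY p hp h9 h3 A B hB hA
  haveI : Finite B.sha := hfinB
  -- the partner: full BSD (Burungale–Flach), `Ш(A)` finite, `ord₂ qA = ord₂ #Ш(A)`
  have hL : A.entireLFunction 1 ≠ 0 := (A.analyticRank_eq_zero_iff_holds (hmod A)).1 hA0
  have hT : A.BSDTriple := hCM0 A (hasCM_of_variableChange_eq hA) hL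
  haveI : Finite A.sha := hT.2.1
  obtain ⟨-, -, qA', hqA', hvA⟩ := forall_bsdp_of_bsdTriple' A hT 2 Nat.prime_two
  have hqq : qA' = qA := by exact_mod_cast hqA'.symm.trans hqA
  subst hqq
  -- the member: `BSD(B, 2)` gives `ord₂ qB = ord₂ #Ш(B)[2^∞]`
  obtain ⟨-, -, qB', hqB', hvB⟩ := hb
  have hqq : qB' = qB := by exact_mod_cast hqB'.symm.trans hqB
  subst hqq
  obtain ⟨hqB0, hqA0⟩ := mul_ne_zero_iff.mp hne
  -- Cassels–Tate: both orders are squares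
  obtain ⟨kB, hkB⟩ := exists_two_mul_eq_padicValNat_of_isSquare
    (WeierstrassCurve.isSquare_card_sha_of_finite_of_casselsTate hCT B) Nat.card_pos.ne'
  obtain ⟨kA, hkA⟩ := exists_two_mul_eq_padicValNat_of_isSquare
    (WeierstrassCurve.isSquare_card_sha_of_finite_of_casselsTate hCT A) Nat.card_pos.ne'
  refine ⟨qB', qA', hqB, hqA, hne, kB + kA, ?_⟩
  rw [padicValRat.mul hqB0 hqA0, hvB, hvA, padicValNat_card_addPrimaryComponent 2,
    padicValNat_card_addPrimaryComponent 2, hkB, hkA]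
  push_cast
  ring

/-- **FIRST RUNG: the members of conductor `< 5000`.** For `B ≅ E_p` globally minimal with
`N(B) < 5000` (displayed Cremona datum) and any minimal partner `A ≅ E_{3p²}`, the clause of
`TwoAdicPairHSY` at `(A, B)` HOLDS from print: Hu–Shu–Yin (rank `E_p(ℚ) = 1`), Creutz–Miller 2012
(`bsdTriple_of_rank_le_one_of_conductor_lt` ⇒ `BSD(B, 2)`), then `twoAdicPair_of_bsdp_two`.
[cite: CreutzMiller2012, Thm 1.1] [cite: HuShuYin2019, Thm. 1.3 (p. 3)] [cite: SilvermanAEC2009, Thm. X.4.14] -/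
theorem twoAdicPair_of_conductor_lt (hHSY : thm14_threePart_product)
    (hCM0 : bsdTriple_of_hasCM_of_L_one_ne_zero) (hmod : hasEntireLFunction_rat)
    (hCM : bsdTriple_of_rank_le_one_of_conductor_lt)
    (hCT : WeierstrassCurve.exists_casselsTate_pairing (K := ℚ))
    (hp : p.Prime) (h9 : p % 9 = 4 ∨ p % 9 = 7) (h3 : ¬ ∃ x : ZMod p, x ^ 3 = 3)
    (A B : WeierstrassCurve ℚ) [A.IsElliptic] [A.IsGloballyMinimal] [B.IsElliptic]
    [B.IsGloballyMinimal] (hB : ∃ C : VariableChange ℚ, C • B = cubeSumCurve (p : ℚ))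
    (hA : ∃ C : VariableChange ℚ, C • A = cubeSumCurve (3 * (p : ℚ) ^ 2))
    (hN : B.conductorNorm ℤ < 5000) :
    ∃ qB qA : ℚ, shaAn B = (qB : ℂ) ∧ shaAn A = (qA : ℂ) ∧ qB * qA ≠ 0 ∧
      ∃ n : ℕ, padicValRat 2 (qB * qA) = 2 * n := by
  obtain ⟨hrk, -⟩ := hHSY p hp h9 h3 A B hB hA
  have hT : B.BSDTriple := hCM B (by rw [hrk]) hN
  exact twoAdicPair_of_bsdp_two hHSY hCM0 hmod hCT hp h9 h3 A B hB hA
    (forall_bsdp_of_bsdTriple' B hT 2 Nat.prime_two)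

end Member

/-! ## §2 Honesty clause: the rung leaf (+ Cassels–Tate) gives the crux back -/

/-- **`X12.CMAtTwo` + Cassels–Tate ⇒ `TwoAdicPairHSY` (verbatim).** Granted `PublishedFactsTwo` and
the Cassels–Tate squareness fact, the rung leaf implies the new crux 19580: the D98 split
`19476 ⟸ 19580 ∧ 19581` does not ask for more than `BSD(E_p, 2)` on the class plus print. (The
converse direction — that 19580 is much WEAKER than the leaf — is the point of the split: it is the
cell's paper theorem.) [cite: SilvermanAEC2009, Thm. X.4.14] [cite: Miller2011LMS, Def. 1.1]
[cite: HuShuYin2019, (bsd) p. 12] -/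
theorem twoAdicPair_of_cmAtTwo (hF : PublishedFactsTwo)
    (hCT : WeierstrassCurve.exists_casselsTate_pairing (K := ℚ)) (hleaf : X12.CMAtTwo) :
    TwoAdicPairHSY := by
  have hF' := hF
  obtain ⟨hHSY, hCM0, hmod, -⟩ := hF'
  intro p hp h9 h3 A B _ _ _ _ hB hA
  exact twoAdicPair_of_bsdp_two hHSY hCM0 hmod hCT hp h9 h3 A B hB hA (hleaf p hp h9 h3 B hB)

/-! ## §3 The crux's body at `p = 7` and `p = 13`, for ALL minimal models -/

/-- Conductor transport: every globally minimal `B` with `C • B = cubeSumCurve p` has the conductor of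
`sylvesterCurve p` (`N` is an isomorphism invariant, `conductorNorm_smul_rat`). [folklore] -/
theorem conductorNorm_eq_of_model {p : ℕ} (hp : p ≠ 0) (B : WeierstrassCurve ℚ) [B.IsElliptic]
    (hB : ∃ C : VariableChange ℚ, C • B = cubeSumCurve (p : ℚ)) :
    B.conductorNorm ℤ = (X12.Sylvester.sylvesterCurve p).conductorNorm ℤ := by
  haveI := X12.Sylvester.isElliptic_sylvesterCurve hp
  obtain ⟨C, hC⟩ := hB
  rw [← WeierstrassCurve.conductorNorm_smul_rat B C, hC, ← X12.Sylvester.sylvesterScale_smul p,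
    WeierstrassCurve.conductorNorm_smul_rat]

/-- **`TwoAdicPairHSY` at `p = 7` (`E₇ = 441b`)**: the crux's body verbatim with `p := 7`, for ALL
globally minimal models `B ≅ E₇`, `A ≅ E_{147}`, from print (Hu–Shu–Yin, Creutz–Miller, Burungale–Flach,
Cassels–Tate, modularity) modulo the displayed Cremona datum `N(sylvesterCurve 7) = 441`.
[cite: CreutzMiller2012, Thm 1.1] [cite: HuShuYin2019, Thm. 1.4 (p. 3)] [cite: SilvermanAEC2009, Thm. X.4.14] -/
theorem twoAdicPairHSY_at_seven (hHSY : thm14_threePart_product)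
    (hCM0 : bsdTriple_of_hasCM_of_L_one_ne_zero) (hmod : hasEntireLFunction_rat)
    (hCM : bsdTriple_of_rank_le_one_of_conductor_lt)
    (hCT : WeierstrassCurve.exists_casselsTate_pairing (K := ℚ))
    (hN : (X12.Sylvester.sylvesterCurve 7).conductorNorm ℤ = 441) :
    ∀ (A B : WeierstrassCurve ℚ) [A.IsElliptic] [A.IsGloballyMinimal] [B.IsElliptic]
      [B.IsGloballyMinimal], (∃ C : VariableChange ℚ, C • B = cubeSumCurve ((7 : ℕ) : ℚ)) →
      (∃ C : VariableChange ℚ, C • A = cubeSumCurve (3 * ((7 : ℕ) : ℚ) ^ 2)) →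
      ∃ qB qA : ℚ, shaAn B = (qB : ℂ) ∧ shaAn A = (qA : ℂ) ∧ qB * qA ≠ 0 ∧
        ∃ n : ℕ, padicValRat 2 (qB * qA) = 2 * n := by
  intro A B _ _ _ _ hB hA
  exact twoAdicPair_of_conductor_lt hHSY hCM0 hmod hCM hCT (p := 7) (by norm_num)
    seven_and_thirteen_mem.1.1 seven_and_thirteen_mem.1.2 A B hB hA
    (by rw [conductorNorm_eq_of_model (by norm_num) B hB, hN]; norm_num)

/-- **`TwoAdicPairHSY` at `p = 13` (`E₁₃ = 4563b`)**: the crux's body verbatim with `p := 13`, for ALL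
globally minimal models `B ≅ E₁₃`, `A ≅ E_{507}`, from print modulo the displayed Cremona datum
`N(sylvesterCurve 13) = 4563`. (The memo's value `n(13) = 1` — `#Ш_an(E₁₃)·#Ш_an(E₅₀₇) = 1·4` — is
NOT asserted; only `n ∈ ℕ`.) [cite: CreutzMiller2012, Thm 1.1] [cite: HuShuYin2019, Thm. 1.4 (p. 3)]
[cite: SilvermanAEC2009, Thm. X.4.14] -/
theorem twoAdicPairHSY_at_thirteen (hHSY : thm14_threePart_product)
    (hCM0 : bsdTriple_of_hasCM_of_L_one_ne_zero) (hmod : hasEntireLFunction_rat)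
    (hCM : bsdTriple_of_rank_le_one_of_conductor_lt)
    (hCT : WeierstrassCurve.exists_casselsTate_pairing (K := ℚ))
    (hN : (X12.Sylvester.sylvesterCurve 13).conductorNorm ℤ = 4563) :
    ∀ (A B : WeierstrassCurve ℚ) [A.IsElliptic] [A.IsGloballyMinimal] [B.IsElliptic]
      [B.IsGloballyMinimal], (∃ C : VariableChange ℚ, C • B = cubeSumCurve ((13 : ℕ) : ℚ)) →
      (∃ C : VariableChange ℚ, C • A = cubeSumCurve (3 * ((13 : ℕ) : ℚ) ^ 2)) →
      ∃ qB qA : ℚ, shaAn B = (qB : ℂ) ∧ shaAn A = (qA : ℂ) ∧ qB * qA ≠ 0 ∧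
        ∃ n : ℕ, padicValRat 2 (qB * qA) = 2 * n := by
  intro A B _ _ _ _ hB hA
  exact twoAdicPair_of_conductor_lt hHSY hCM0 hmod hCM hCT (p := 13) (by norm_num)
    seven_and_thirteen_mem.2.1 seven_and_thirteen_mem.2.2 A B hB hA
    (by rw [conductorNorm_eq_of_model (by norm_num) B hB, hN]; norm_num)

end Summit.BirchSwinnertonDyer.BirchSwinnertonDyer.Theorems.SylvesterTwoUpper

end
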